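import Mathlib.Probability.ConditionalProbability
import Mathlib.Analysis.SpecialFunctions.Trigonometric.Basic
import Mathlib.Topology.ContinuousMap.Bounded.Basic
import Mathlib.MeasureTheory.Integral.Bochner.Basic
import Literature.Probability.Percolation.QuadCrossingSpaceZ2
import HarnessLib

/-!
# Garban–Pete–Schramm's normalised pivotal (ε-important) measures for bond percolation on `δℤ²`

Topic `Literature/Probability/Percolation`; part (d) of definition request `defn-FlipFairKernel`
(route `Summits/CriticalPhenomena/CardyFormulaZ2/Theses/CardyMeckeFlip`, item FlipIdentityZ2 and
the foreseen split child PivotalKernelErgodic): the LATTICE kernels whose joint subsequential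
limits with the quad-crossing configuration are the intended witnesses `M ε` of the flip identity,
and the statement shape "`M` is such a limit".  The continuum notions ((ADM), (F), (EXT), the
pivotal predicate) are the sibling file `FlipFairKernel.lean`; the two files are independent.

**Sources (held, read).**  C. Garban, G. Pete, O. Schramm, JEMS 20 (2018), arXiv:1305.5526, §2.6:
"a point `x ∈ η𝕋 ∩ Δ` is `A`-important for `ω_η` if one can find four alternating arms in `ω_η`
from `x` to the exterior boundary `∂₂A`"; "`μ^A(ω_η) := Σ_{x A-important} δ_x η² α₄^η(η,1)⁻¹`";
"For each `ε > 0`, consider the grid `εℤ² ∩ D` … To each such square `Q` we associate the square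
`Q̃` of side-length `3ε` centered around `Q` and the annulus `A_Q` with `∂₁A_Q = ∂Q`, `∂₂A_Q = ∂Q̃`.
Definition. `Piv^ε(ω_η)` is the set of points `x` which belong to an `ε`-square `Q` of the grid
`εℤ²` and are `A_Q`-important … `μ^ε(ω_η) := Σ_{x ∈ Piv^ε(ω_η)} δ_x η² α₄^η(η,1)⁻¹`"; Corollary:
"`(ω_η, μ^ε(ω_η)) →(d) (ω_∞, μ^ε(ω_∞))` under the product topology", `μ^ε` a measurable map on
`ℋ`; notation table §1: "`r(η) := η² α₄^η(η,1)⁻¹`, the renormalized rate".  C. Garban, G. Pete,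
O. Schramm, JAMS 26 (2013), arXiv:1008.1378, §2.1: "`α_k^η(η, R)` will always denote the `k`-arm
probability from a single site to radius `R`", "`B_r` the square of Euclidean radius `r`"; §4.1
(4.1)–(4.3) (the same measures); §1 p. 10 and §4.3: grids "`2ε e^{iθ}ℤ² + a`", the averaging over "the shifts `a ∈ [0,ε)²`
and angles `θ ∈ [0,2π)`" of the grid, and: "for critical bond percolation on `ℤ²` … whenever the scaling
limit of static percolation exists along a subsequence `{η_k}`, the scaling limit of the normalized
measures also exists along that subsequence".

**Transcription to bond-`ℤ²`** (namespace `Literature.Probability.Percolation`; sites `Site 2`,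
graph `zdGraph 2`, mesh-`δ` drawing `meshPoint δ`, law `bondPercolation (zdGraph 2) half`, as in
`QuadCrossingSpaceZ2.lean`).  The flipped objects are EDGES; an edge is `edgeFrom x i =
s(x, x + eᵢ)` (each edge of `ℤ²` exactly once as `(x, i) : Site 2 × Fin 2`), drawn with midpoint
`edgeMidpoint δ x i`.
* `edgeFourArm W x i` — **four alternating arms from the edge to `∂W`** inside a vertex block
  `W`, in the tree's duality-free CLUSTER FORM (as `fourArmTwoClusters`, `FourArmGarban.lean`):
  with the edge itself removed, both endpoints are joined inside `W` to the vertex boundary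
  `vertexBoundary W` by open paths and are NOT joined to each other inside `W` (the two closed
  dual arms are then automatic on the self-dual square lattice, Kesten's dictionary).  It does not
  look at the state of the edge (`mem_edgeFourArm_symmDiff_iff`) — the structural reason the
  lattice flip identity of the route (item LatticeFlipIdentity) is exact at `p = 1/2`.
* `pivotalRate δ = δ² / z2EdgeFourArmProb δ` — GPS's `r(η) = η² α₄^η(η,1)⁻¹`, with `α₄(δ,1)` the
  probability of four arms from the edge `s(0, e₀)` to the boundary of the square of Euclidean
  radius `1` (`unitBlock δ`).  Junk: `0` when that probability vanishes (e.g. `δ > 1`).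
* Moved `ε`-grids: `gridFrame θ s` (rotate back by `θ`, reflect if `s`), `gridCoord ε θ s a`
  (coordinates in the grid frame, the shift `a` in GRID UNITS, so that the grid squares are
  `M_{θ,s}(ε(k + a + [0,1)²))` and depend on `a` only modulo `ℤ²`: `gridImportant_add_int`),
  `gridIndex` (the `ε`-square containing a point, squares half-open), `gridBlock ε θ s a δ k` (the
  lattice sites drawn in the concentric `3ε`-square `Q̃`), `gridImportant` (= `edgeFourArm` for
  the block of the square containing the edge's midpoint); `z2GridPivotalMeasure ε θ s a δ ω` —
  **GPS's `μ^ε(ω_δ)`** for that grid: `Σ_{e ε-important} r(δ) δ_{midpoint e}` (`Measure.sum` of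
  weighted Dirac masses).
* `z2PivotalMeasure ε δ ω` — the **isometry-averaged** version requested by the route: the weight
  of an edge is `r(δ) ×` the probability that it is `ε`-important for a uniformly moved grid,
  `(θ, a) ∼ gridParamLaw` = normalised Lebesgue measure on `[0,2π) × [0,1)²` and the orientation
  `s` fair (GPS 2013 p. 10 average over shifts and angles; the shift is uniform on a fundamental
  domain of the ROTATED grid lattice, which is what makes the parameter law invariant under the
  action of every plane isometry — see `gridParamSet`).  Written weight-wise so that no
  measurability in the grid parameters is needed to define it; `z2PivotalMeasure_apply`.
* `IsZ2PivotalKernelLimit μ M` — **the statement shape**: along some mesh sequence `δ_k → 0⁺`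
  realising `μ` as the weak limit of `z2QuadLaw univ δ_k`, for every cutoff `ε > 0` the pair
  (configuration, `z2PivotalMeasure ε δ_k`) converges in law to `(S, M ε S)`, `S ∼ μ` — GPS 2018
  §2.6 Cor. with the limit random measure a FUNCTION of the configuration, as printed, and with
  GPS 2013 p. 10's proviso (same subsequence) built in.  On the whole plane the measures are only
  locally finite, so "in law under the product topology" is rendered in the vague,
  finite-dimensional form: joint convergence of `(S, ⟨μ^ε, φ₁⟩, …, ⟨μ^ε, φ_m⟩)` against bounded
  continuous `F`, for all finite families `φⱼ ∈ C_c(ℂ)`.  `IsZ2PivotalKernelLimit.mem_subseqQuadLimits`.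

**Deliberately NOT here**: existence of the limit (tightness, GPS 2013 §4.2–4.5 on `ℤ²`),
measurability of `ω ↦ μ^ε_δ(ω)` and of the limit kernel, the identification of lattice importance
with the continuum predicate `IsPivotalAt` in the limit — all route items (FlipIdentityZ2 and its
foreseen children), not definitions.  The uniform measure on the drawn segment of an edge (a
variant named in the request) is replaced by the Dirac mass at its midpoint, which is GPS's `δ_x`
and has the same `δ → 0` limits.

## Mathlib / tree search

Tree, reused: `openConnIn` (`Percolation.lean`), `fourArmTwoClusters` (cluster form of four arms,
`FourArmGarban.lean` — for annuli around the origin; here the inner boundary is an edge, hence a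
new event of the same shape), `meshPoint`, `z2QuadConfig`, `z2QuadLaw`, `isSubseqQuadLimit_iff`
(`QuadCrossingSpaceZ2.lean`), coordinate pivotality `IsPivotal` (`PercolationEvents.lean`, used by
item LatticeFlipIdentity inline; not needed here).  Mathlib: `Measure.sum`, `Measure.dirac`,
`ProbabilityTheory.cond` (normalised restriction), `BoundedContinuousFunction`, `Int.floor`.
`lean search 'pivotalMeasure|importantPoints|PivotalKernel'`: nothing.

## References

* [GarbanPeteSchramm2018] C. Garban, G. Pete, O. Schramm, JEMS 20 (2018), arXiv:1305.5526, §1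
  (notation `r(η)`), §2.6 (Definitions of `A`-important points, `μ^A`, `Piv^ε`, `μ^ε`; Corollary on
  the joint limit; Proposition on moments).
* [GarbanPeteSchramm2013Pivotal] C. Garban, G. Pete, O. Schramm, JAMS 26 (2013), arXiv:1008.1378,
  §2.1 (`α₄^η(η,R)`, `B_r`), §4.1 (4.1)–(4.3), §1 p. 10 (averaged grids; bond-`ℤ²` subsequences).
* [SchrammSmirnov2011] O. Schramm, S. Smirnov, Ann. Probab. 39 (2011), §1.3 (the space `ℋ`).
-/

noncomputable section

open Set Filter
open _root_.MeasureTheory _root_.Topology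
open scoped ENNReal symmDiff

namespace Literature.Probability.Percolation

open QuadCrossing LatticeModels

/-! ### Edges of `ℤ²`, their drawing, vertex boundaries -/

/-- The edge of `ℤ²` from the site `x` in the coordinate direction `i`, `s(x, x + eᵢ)` (every edge
of `zdGraph 2` arises exactly once this way). [folklore] -/
def edgeFrom (x : Site 2) (i : Fin 2) : Sym2 (Site 2) := s(x, x + Pi.single i 1)

/-- `edgeFrom x i` is an edge of `ℤ²`. [folklore] -/
theorem edgeFrom_mem_edgeSet (x : Site 2) (i : Fin 2) : edgeFrom x i ∈ (zdGraph 2).edgeSet :=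
  (zdGraph_adj_iff x _).2 ⟨i, Or.inl rfl⟩

/-- The midpoint of the edge `edgeFrom x i` drawn at mesh `δ` (vertices at `meshPoint δ`).
[folklore] -/
def edgeMidpoint (δ : ℝ) (x : Site 2) (i : Fin 2) : ℂ :=
  (meshPoint δ x + meshPoint δ (x + Pi.single i 1)) / 2

/-- The (inner) vertex boundary of a set of sites `W ⊆ ℤ²`: the sites of `W` with a neighbour
outside `W`. [folklore] -/
def vertexBoundary (W : Set (Site 2)) : Set (Site 2) :=
  {v | v ∈ W ∧ ∃ u, u ∉ W ∧ (zdGraph 2).Adj v u}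

/-- `vertexBoundary_subset`: structural lemma. [folklore] -/
theorem vertexBoundary_subset (W : Set (Site 2)) : vertexBoundary W ⊆ W := fun _ h => h.1

/-! ### Four alternating arms from an edge (cluster form) -/

/-- **Four alternating arms from the edge `e = s(x, x + eᵢ)` to `∂W`** (Garban–Pete–Schramm's
"`A`-important", the inner boundary of the annulus shrunk to the edge), for bond percolation on
`ℤ²` in duality-free cluster form: in the configuration with `e` removed, both endpoints of `e` are
joined inside `W` to the vertex boundary of `W` by open paths, and they are not joined to each
other inside `W` (so two disjoint closed dual arms from `e*` to `∂W` separate the two open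
clusters — the `o c o c` pattern, as in the tree's `fourArmTwoClusters`).  The state of `e`
itself is irrelevant. [cite: GarbanPeteSchramm2018, §2.6 (Definition: A-important points)] -/
def edgeFourArm (W : Set (Site 2)) (x : Site 2) (i : Fin 2) : Set (BondConfig (Site 2)) :=
  {ω | (∃ u ∈ vertexBoundary W, ω \ {edgeFrom x i} ∈ openConnIn W x u) ∧
    (∃ u ∈ vertexBoundary W, ω \ {edgeFrom x i} ∈ openConnIn W (x + Pi.single i 1) u) ∧
      ω \ {edgeFrom x i} ∉ openConnIn W x (x + Pi.single i 1)}

/-- The four-arm event of an edge depends on the configuration only off that edge. [folklore] -/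
theorem mem_edgeFourArm_congr {W : Set (Site 2)} {x : Site 2} {i : Fin 2}
    {ω ω' : BondConfig (Site 2)} (h : ω \ {edgeFrom x i} = ω' \ {edgeFrom x i}) :
    ω ∈ edgeFourArm W x i ↔ ω' ∈ edgeFourArm W x i := by
  simp only [edgeFourArm, mem_setOf_eq, h]

/-- Flipping a coordinate and then deleting it is deleting it. [folklore] -/
theorem symmDiff_singleton_sdiff_singleton {α : Type*} (ω : Set α) (e : α) :
    (ω ∆ {e}) \ {e} = ω \ {e} := by
  ext f
  by_cases hf : f = e <;> simp [Set.symmDiff_def, hf]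

/-- **Flipping the edge does not change its four-arm event** (`ω ↦ ω Δ {e}`): the weight an edge
receives in the pivotal measures below is symmetric under the flip at that edge — the structural
input of the exact lattice flip (Campbell–Mecke) identity at `p = 1/2`. [folklore] -/
theorem mem_edgeFourArm_symmDiff_iff (W : Set (Site 2)) (x : Site 2) (i : Fin 2)
    (ω : BondConfig (Site 2)) :
    ω ∆ {edgeFrom x i} ∈ edgeFourArm W x i ↔ ω ∈ edgeFourArm W x i :=
  mem_edgeFourArm_congr (symmDiff_singleton_sdiff_singleton ω _)

/-! ### The normalisation `r(δ) = δ² / α₄(δ, 1)` -/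

/-- The lattice sites drawn, at mesh `δ`, in the closed square `[-1,1]²` of Euclidean radius `1`
(GPS's `B_1`). [cite: GarbanPeteSchramm2013Pivotal, §2.1 (B_r, the square of Euclidean radius r)] -/
def unitBlock (δ : ℝ) : Set (Site 2) := {v | ∀ j : Fin 2, |δ * (v j : ℝ)| ≤ 1}

/-- **`α₄(δ, 1)` for bond-`ℤ²` at `p = 1/2`**: the probability of four alternating arms from the
edge `s(0, e₀)` to the boundary of the square of Euclidean radius `1`, at mesh `δ` ("the four-arm
probability from a single site to radius `1`", transcribed to an edge). [cite: GarbanPeteSchramm2013Pivotal, §2.1 (α₄^η(η,R)) and §4.1 (normalisation)] -/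
def z2EdgeFourArmProb (δ : ℝ) : ℝ :=
  (bondPercolation (zdGraph 2) half).real (edgeFourArm (unitBlock δ) 0 0)

/-- **The renormalised rate `r(δ) := δ² α₄(δ,1)⁻¹`** (GPS: `= η^{3/4+o(1)}` on the triangular
lattice; on `ℤ²` only `δ^{2-α₄+o(1)}` with `α₄` unknown), the mass of one `ε`-important edge.
Junk value `0` if `α₄(δ,1) = 0`. [cite: GarbanPeteSchramm2018, §1 (Notations: the renormalized rate r(η))] -/
def pivotalRate (δ : ℝ) : ℝ := δ ^ 2 / z2EdgeFourArmProb δ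

/-- `pivotalRate_nonneg`: the rate is non-negative. [folklore] -/
theorem pivotalRate_nonneg (δ : ℝ) : 0 ≤ pivotalRate δ :=
  div_nonneg (sq_nonneg δ) measureReal_nonneg

/-! ### Moved `ε`-grids and `ε`-important edges -/

/-- The linear part of a grid frame: rotate back by the angle `θ` and, if `s`, reflect in the real
axis — the inverse of the plane isometry `M_{θ,s} : z ↦ e^{iθ} z` (`s = false`) /
`z ↦ e^{iθ} z̄` (`s = true`) fixing the origin. [folklore] -/
def gridFrame (θ : ℝ) (s : Bool) (z : ℂ) : ℂ :=
  if s then (starRingEnd ℂ) (Complex.exp (-(θ * Complex.I)) * z)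
  else Complex.exp (-(θ * Complex.I)) * z

/-- **Coordinates of `z` in the moved `ε`-grid** with parameters `(θ, s, a)`: `gridFrame θ s z / ε - a`,
the shift `a` being measured IN GRID UNITS.  The grid squares are `{z | gridCoord z ∈ k + [0,1)²}`,
`k ∈ ℤ²`, i.e. the images `M_{θ,s}(ε(k + a + [0,1)²))` of the standard `ε`-grid shifted by `εa`
— GPS's "`2ε e^{iθ}ℤ² + a`"-type grids (GPS 2013 §4.3), with the shift parametrised in the grid
frame so that, for every `θ`, `a ∼ Unif[0,1)²` is the Haar probability on the torus of shifts
(the grid depends on `a` only modulo `ℤ²`, `gridImportant_add_int`). [cite: GarbanPeteSchramm2013Pivotal, §1 p. 10 and §4.3 (shifted and rotated ε-grids)] -/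
def gridCoord (ε θ : ℝ) (s : Bool) (a z : ℂ) : ℂ := gridFrame θ s z / ε - a

/-- The index `k ∈ ℤ²` of the (half-open) `ε`-square of the moved grid containing `z`. [cite: GarbanPeteSchramm2018, §2.6 (the ε-square Q containing x)] -/
def gridIndex (ε θ : ℝ) (s : Bool) (a z : ℂ) : ℤ × ℤ :=
  (⌊(gridCoord ε θ s a z).re⌋, ⌊(gridCoord ε θ s a z).im⌋)

/-- The block of lattice sites (mesh `δ`) drawn in `Q̃`, "the square of side-length `3ε` centered
around" the `ε`-square `Q` of index `k`: grid coordinates in `k + [-1,2]²`. [cite: GarbanPeteSchramm2018, §2.6 (the square Q̃ and the annulus A_Q)] -/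
def gridBlock (ε θ : ℝ) (s : Bool) (a : ℂ) (δ : ℝ) (k : ℤ × ℤ) : Set (Site 2) :=
  {v | (gridCoord ε θ s a (meshPoint δ v)).re ∈ Icc ((k.1 : ℝ) - 1) (k.1 + 2) ∧
    (gridCoord ε θ s a (meshPoint δ v)).im ∈ Icc ((k.2 : ℝ) - 1) (k.2 + 2)}

/-- **The edge `s(x, x + eᵢ)` of `δℤ²` is `ε`-important** for the moved grid `(θ, s, a)`: it has
four alternating arms to `∂Q̃`, where `Q` is the `ε`-square containing its midpoint (GPS's
`x ∈ Piv^ε(ω_η)`, sites of `η𝕋` replaced by edges of `δℤ²`). [cite: GarbanPeteSchramm2018, §2.6 (Definition of Piv^ε)] -/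
def gridImportant (ε θ : ℝ) (s : Bool) (a : ℂ) (δ : ℝ) (x : Site 2) (i : Fin 2) :
    Set (BondConfig (Site 2)) :=
  edgeFourArm (gridBlock ε θ s a δ (gridIndex ε θ s a (edgeMidpoint δ x i))) x i

/-- `ε`-importance of an edge is unchanged by flipping that edge. [folklore] -/
theorem mem_gridImportant_symmDiff_iff (ε θ : ℝ) (s : Bool) (a : ℂ) (δ : ℝ) (x : Site 2)
    (i : Fin 2) (ω : BondConfig (Site 2)) :
    ω ∆ {edgeFrom x i} ∈ gridImportant ε θ s a δ x i ↔ ω ∈ gridImportant ε θ s a δ x i :=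
  mem_edgeFourArm_symmDiff_iff _ x i ω

/-- Shifting the grid by an integer vector (in grid units) shifts the coordinates. [folklore] -/
theorem gridCoord_add_int (ε θ : ℝ) (s : Bool) (a z : ℂ) (k : ℤ × ℤ) :
    gridCoord ε θ s (a + ⟨k.1, k.2⟩) z = gridCoord ε θ s a z - ⟨k.1, k.2⟩ := by
  simp only [gridCoord]; ring

/-- … and the index of the square containing a point by the same vector. [folklore] -/
theorem gridIndex_add_int (ε θ : ℝ) (s : Bool) (a z : ℂ) (k : ℤ × ℤ) :
    gridIndex ε θ s (a + ⟨k.1, k.2⟩) z =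
      ((gridIndex ε θ s a z).1 - k.1, (gridIndex ε θ s a z).2 - k.2) := by
  simp only [gridIndex, gridCoord_add_int, Complex.sub_re, Complex.sub_im, Int.floor_sub_intCast]

/-- … while the blocks, re-indexed, are the same sets of sites. [folklore] -/
theorem gridBlock_add_int (ε θ : ℝ) (s : Bool) (a : ℂ) (δ : ℝ) (j k : ℤ × ℤ) :
    gridBlock ε θ s (a + ⟨k.1, k.2⟩) δ (j.1 - k.1, j.2 - k.2) = gridBlock ε θ s a δ j := by
  ext v
  simp only [gridBlock, mem_setOf_eq, gridCoord_add_int, Complex.sub_re, Complex.sub_im, mem_Icc,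
    Int.cast_sub]
  constructor <;> rintro ⟨⟨h₁, h₂⟩, h₃, h₄⟩ <;> exact ⟨⟨by linarith, by linarith⟩, by linarith, by linarith⟩

/-- **The moved grid depends on the shift only modulo `ℤ²`**: integer shifts (in grid units) do
not change which edges are `ε`-important. [folklore] -/
theorem gridImportant_add_int (ε θ : ℝ) (s : Bool) (a : ℂ) (δ : ℝ) (k : ℤ × ℤ) (x : Site 2)
    (i : Fin 2) : gridImportant ε θ s (a + ⟨k.1, k.2⟩) δ x i = gridImportant ε θ s a δ x i := by
  simp only [gridImportant, gridIndex_add_int, gridBlock_add_int]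

/-! ### The pivotal measures -/

/-- **GPS's pivotal measure `μ^ε(ω_δ)` for bond-`ℤ²` at mesh `δ` and the moved grid `(θ, s, a)`**:
`Σ_{e ε-important} r(δ) · δ_{midpoint of e}`, a locally finite sum of weighted Dirac masses in the
plane (indexed by `(x, i) : Site 2 × Fin 2`, i.e. over the edges `s(x, x + eᵢ)`). [cite: GarbanPeteSchramm2018, §2.6 (Definition of μ^ε)] -/
def z2GridPivotalMeasure (ε θ : ℝ) (s : Bool) (a : ℂ) (δ : ℝ) (ω : BondConfig (Site 2)) :
    Measure ℂ :=
  Measure.sum fun p : Site 2 × Fin 2 =>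
    (gridImportant ε θ s a δ p.1 p.2).indicator (fun _ => ENNReal.ofReal (pivotalRate δ)) ω •
      Measure.dirac (edgeMidpoint δ p.1 p.2)

/-- The continuous grid parameters averaged over: angles `θ ∈ [0, 2π)` and shifts
`a = a₁ + i a₂` IN GRID UNITS, `(a₁, a₂) ∈ [0, 1)²` (GPS: "the uniform measure on the shifts and
angles"; the reflection bit `s` is averaged separately with weights `½, ½`).  With this
parametrisation the law of the moved grid is invariant under every plane isometry `h`: `h`
acts on the parameters by `θ ↦ θ ∓ α (mod 2π)` (rotation angle `α` of `h`), `s ↦ s` or `¬ s`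
(orientation), and, for each fixed `(θ, s)`, a translation `a ↦ a - c (mod ℤ²)` — all
measure-preserving; this is what makes the averaged kernel equivariant in law under the lattice
symmetries and its scaling limits equivariant under all isometries once the limit law is
isometry-invariant (route CardyMeckeFlip, items FlipIdentityZ2 / Z2LimitsSymmetric). [cite: GarbanPeteSchramm2013Pivotal, §1 p. 10 (averaging over shifted and rotated grids)] -/
def gridParamSet : Set (ℝ × ℝ × ℝ) :=
  Ico 0 (2 * Real.pi) ×ˢ (Ico 0 1 ×ˢ Ico 0 1)

/-- The uniform probability on the continuous grid parameters: Lebesgue measure on `ℝ³`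
conditioned on `gridParamSet` (`ProbabilityTheory.cond`). [cite: GarbanPeteSchramm2013Pivotal, §1 p. 10 (uniform measure on shifts and angles)] -/
def gridParamLaw : Measure (ℝ × ℝ × ℝ) :=
  ProbabilityTheory.cond volume gridParamSet

/-- The shift `a = a₁ + i a₂ ∈ ℂ` (grid units) of a grid parameter `(θ, a₁, a₂)`. [folklore] -/
def gridShift (q : ℝ × ℝ × ℝ) : ℂ := ⟨q.2.1, q.2.2⟩

/-- The volume of the parameter box is `2π`. [folklore] -/
theorem volume_gridParamSet : volume gridParamSet = ENNReal.ofReal (2 * Real.pi) := by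
  simp only [gridParamSet, Measure.volume_eq_prod, Measure.prod_prod, Real.volume_Ico, sub_zero,
    ENNReal.ofReal_one, mul_one]

/-- The parameter law is a probability measure. [folklore] -/
instance isProbabilityMeasure_gridParamLaw : IsProbabilityMeasure gridParamLaw := by
  have hπ : (0 : ℝ) < 2 * Real.pi := by positivity
  refine ProbabilityTheory.cond_isProbabilityMeasure_of_finite ?_ ?_
  · rw [volume_gridParamSet]
    exact (ENNReal.ofReal_pos.2 hπ).ne'
  · rw [volume_gridParamSet]
    exact ENNReal.ofReal_ne_top

/-- **The averaged weight of the edge `s(x, x + eᵢ)`**: `r(δ)` times the probability, for a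
uniformly moved grid (`(θ, a) ∼ gridParamLaw`, orientation `s` fair), that the edge is
`ε`-important — the average over moved grids of GPS's weight `r(δ) 1{e ∈ Piv^ε}`, written as the
measure of a set of parameters so that no measurability in the parameter is needed to define it.
[cite: GarbanPeteSchramm2013Pivotal, §1 p. 10 (average of the shifted and rotated approximations)] -/
def pivotalWeight (ε δ : ℝ) (ω : BondConfig (Site 2)) (x : Site 2) (i : Fin 2) : ℝ≥0∞ :=
  ENNReal.ofReal (pivotalRate δ) *
    ((gridParamLaw {q | ω ∈ gridImportant ε q.1 false (gridShift q) δ x i} +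
        gridParamLaw {q | ω ∈ gridImportant ε q.1 true (gridShift q) δ x i}) / 2)

/-- The averaged weight of an edge is at most `r(δ)`. [folklore] -/
theorem pivotalWeight_le (ε δ : ℝ) (ω : BondConfig (Site 2)) (x : Site 2) (i : Fin 2) :
    pivotalWeight ε δ ω x i ≤ ENNReal.ofReal (pivotalRate δ) := by
  have h2 : (gridParamLaw {q | ω ∈ gridImportant ε q.1 false (gridShift q) δ x i} +
      gridParamLaw {q | ω ∈ gridImportant ε q.1 true (gridShift q) δ x i}) / 2 ≤ 1 := by
    apply ENNReal.div_le_of_le_mul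
    calc _ ≤ (1 : ℝ≥0∞) + 1 := add_le_add prob_le_one prob_le_one
      _ = 1 * 2 := by rw [one_mul, one_add_one_eq_two]
  calc pivotalWeight ε δ ω x i ≤ ENNReal.ofReal (pivotalRate δ) * 1 := by
        unfold pivotalWeight; gcongr
    _ = ENNReal.ofReal (pivotalRate δ) := mul_one _

/-- **The averaged weight of an edge is symmetric under flipping that edge.** [folklore] -/
theorem pivotalWeight_symmDiff (ε δ : ℝ) (ω : BondConfig (Site 2)) (x : Site 2) (i : Fin 2) :
    pivotalWeight ε δ (ω ∆ {edgeFrom x i}) x i = pivotalWeight ε δ ω x i := by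
  simp only [pivotalWeight, mem_gridImportant_symmDiff_iff]

/-- **The isometry-averaged normalised pivotal measure of bond-`ℤ²` at mesh `δ`, cutoff `ε`**
(route CardyMeckeFlip's lattice kernel): `Σ_e pivotalWeight(e) · δ_{midpoint of e}` — GPS's
`μ^ε(ω_δ)` averaged over the uniformly moved (rotated, possibly reflected, shifted) `ε`-grids.
Its joint subsequential limits with `ω_δ ∈ ℋ` are the intended isometry-equivariant kernels
`M ε` of item FlipIdentityZ2 (`IsZ2PivotalKernelLimit`). [cite: GarbanPeteSchramm2013Pivotal, §1 p. 10 and §4.1 (normalised counting measures, averaged grids)] -/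
def z2PivotalMeasure (ε δ : ℝ) (ω : BondConfig (Site 2)) : Measure ℂ :=
  Measure.sum fun p : Site 2 × Fin 2 =>
    pivotalWeight ε δ ω p.1 p.2 • Measure.dirac (edgeMidpoint δ p.1 p.2)

/-- The averaged pivotal measure of a set: the total weight of the edges whose drawn midpoints
it contains. [folklore] -/
theorem z2PivotalMeasure_apply (ε δ : ℝ) (ω : BondConfig (Site 2)) (s : Set ℂ) :
    z2PivotalMeasure ε δ ω s =
      ∑' p : Site 2 × Fin 2, pivotalWeight ε δ ω p.1 p.2 * s.indicator 1 (edgeMidpoint δ p.1 p.2) := by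
  rw [z2PivotalMeasure, Measure.sum_apply_of_countable]
  simp only [Measure.smul_apply, Measure.dirac_apply, smul_eq_mul]

/-- The fixed-grid pivotal measure of a set, likewise. [folklore] -/
theorem z2GridPivotalMeasure_apply (ε θ : ℝ) (s : Bool) (a : ℂ) (δ : ℝ) (ω : BondConfig (Site 2))
    (t : Set ℂ) :
    z2GridPivotalMeasure ε θ s a δ ω t =
      ∑' p : Site 2 × Fin 2,
        (gridImportant ε θ s a δ p.1 p.2).indicator (fun _ => ENNReal.ofReal (pivotalRate δ)) ω *
          t.indicator 1 (edgeMidpoint δ p.1 p.2) := by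
  rw [z2GridPivotalMeasure, Measure.sum_apply_of_countable]
  simp only [Measure.smul_apply, Measure.dirac_apply, smul_eq_mul]

/-! ### The statement shape: `M` is the joint subsequential limit of the lattice kernels -/

/-- **`M` is a pivotal-kernel limit for `μ`** (the intended witness of item FlipIdentityZ2 and
the object of the foreseen item PivotalKernelErgodic): there is a mesh sequence `δ_k → 0⁺` along
which the quad-crossing laws `z2QuadLaw univ δ_k` of bond-`ℤ²` at `p = 1/2` converge weakly to
`μ` AND, for every cutoff `ε > 0`, the pair (configuration `ω_{δ_k} ∈ ℋ`, averaged normalised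
pivotal measure `z2PivotalMeasure ε δ_k`) converges in law to `(S, M ε S)` with `S ∼ μ` — GPS's
"`(ω_η, μ^ε(ω_η)) →(d) (ω_∞, μ^ε(ω_∞))`, `μ^ε` a measurable map on `ℋ`", along the subsequence
defining `μ` (GPS 2013 p. 10 for `ℤ²`).  The measures live on the whole plane and are only locally
finite, so convergence in law "under the product topology" is stated in vague finite-dimensional
form: for all `φ₁, …, φ_m ∈ C_c(ℂ)` and bounded continuous `F` on `ℋ × ℝ^m`,
`E F(ω_δ, (∫ φⱼ dμ^ε_δ)ⱼ) → ∫ F(S, (∫ φⱼ d(M ε S))ⱼ) dμ(S)`. [cite: GarbanPeteSchramm2018, §2.6 (Corollary: joint convergence in law of (ω_η, μ^ε(ω_η)))] -/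
def IsZ2PivotalKernelLimit (μ : FiniteMeasure (QuadConfig (univ : Set ℂ)))
    (M : ℝ → QuadConfig (univ : Set ℂ) → Measure ℂ) : Prop :=
  ∃ δs : ℕ → ℝ, (∀ k, 0 < δs k) ∧ Tendsto δs atTop (𝓝 0) ∧
    Tendsto (fun k => z2QuadLaw (univ : Set ℂ) (δs k)) atTop (𝓝 μ) ∧
      ∀ ε : ℝ, 0 < ε → ∀ (m : ℕ) (φ : Fin m → ℂ → ℝ), (∀ j, Continuous (φ j)) →
        (∀ j, HasCompactSupport (φ j)) →
          ∀ F : BoundedContinuousFunction (QuadConfig (univ : Set ℂ) × (Fin m → ℝ)) ℝ,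
            Tendsto
              (fun k => ∫ ω, F (z2QuadConfig (univ : Set ℂ) (δs k) ω,
                  fun j => ∫ x, φ j x ∂(z2PivotalMeasure ε (δs k) ω))
                ∂(bondPercolation (zdGraph 2) half))
              atTop
              (𝓝 (∫ S, F (S, fun j => ∫ x, φ j x ∂(M ε S))
                ∂(μ : Measure (QuadConfig (univ : Set ℂ)))))

/-- A pivotal-kernel limit is, in particular, a subsequential quad-crossing scaling limit of
bond-`ℤ²`: `μ ∈ subseqQuadLimits univ` (the route's `Λ`). [cite: SchrammSmirnov2011, Cor. 1.6 (subsequential limits)] -/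
theorem IsZ2PivotalKernelLimit.mem_subseqQuadLimits {μ : FiniteMeasure (QuadConfig (univ : Set ℂ))}
    {M : ℝ → QuadConfig (univ : Set ℂ) → Measure ℂ} (h : IsZ2PivotalKernelLimit μ M) :
    μ ∈ subseqQuadLimits (univ : Set ℂ) := by
  obtain ⟨δs, hpos, h0, hlaw, -⟩ := h
  exact (isSubseqQuadLimit_iff univ μ).2 ⟨δs, hpos, h0, hlaw⟩

end Literature.Probability.Percolation
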